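import Literature.MathematicalPhysics.QuantumFieldTheory.Balaban1983to89.B7Eq84Concrete
import Literature.MathematicalPhysics.QuantumFieldTheory.Balaban1983to89.B7Prop5Flat

/-!
# `Balaban1983to89.B7Eq2BlocksZd` — T. Bałaban, *Averaging operations for lattice gauge theories*, Commun. Math. Phys. **98**
(1985) 17–51 [Balaban1985Averaging], Introduction p. 17–18 [PDF 1–2]: **the level lattices (1), the blocks of order `j` (2) and
the block sets (3) WITH THEIR PRINTED (corner-anchored) BODIES on the concrete unit-lattice carrier `ℤ^d` of the B7 files**, the
tiling assumption (4) for `Ω = ℤ^d`, and the identification of the index sets of the averages (42) ∕ (78) with the block `B(c₋)` ∕ `B(y)`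

statement-level skeleton of published theorems with citation tags; proofs where landed; nothing here is a claim about the Yang–Mills mass gap

PDF held: `paper:balaban1985-cmp98-averaging` (journal page = PDF page + 16); renders `…/1985-cmp98-averaging-p001-x2.png` (p. 17),
`…-p002-x2.png` (p. 18), `…-p007-x2.png` (p. 23), `…-p009-x2.png` (p. 25), `…-p014-x2.png` (p. 30) read as images by the typing seat (unit `lit-balaban-r04`,
gen 52).

CITATION HEADER / PRINT, verbatim.  p. 17: "We consider a subdomain `Ω` of the lattice `ηZ^d` with a lattice spacing `η`. A sequence
of sets `Ω^{(j)}` is defined as the intersections `Ω^{(j)} = Ω ∩ L^jηZ^d`, (1) where `L` is a fixed integer, `L > 1`. For a point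
`y ∈ L^nηZ^d` (or any lattice `δZ^d`), we define a block of an order `j` as the cube `B^j(y) = {x ∈ L^{−j}L^nηZ^d : y_μ ≦ x_μ <
y_μ + L^nη, μ = 1, …, d}` (2) (or the corresponding cube with `L^nη` replaced by `δ`). We will omit the subscript `j` if `j = 1`. For a
subset `Λ ⊂ L^nηZ^d` (or `⊂ δZ^d`), we define `B^j(Λ) = ⋃_{y∈Λ} B^j(y) ⊂ L^{−j}L^nηZ^d` (or `⊂ L^{−j}δZ^d`). (3)"  p. 18: "We assume
that `B^j(Ω^{(j)}) = Ω` for `j = 1, …, k` (4) for some `k`. In fact, we will assume that `η = L^{−k}`. Thus `Ω` is a sum of blocks of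
the order `k`."  p. 23 (42): "`Ū_c = exp[i Σ_{x∈B(c₋)} L^{−d} (1/i) log U(Γ_{c,x})U(c)⁻¹]U(c), c ⊂ Ω^{(1)}`"; p. 30 (78): "`(R̄₀v)(y) = …
= v(y)exp[i Σ_{x∈B(y)} L^{−d} (1/i) log v⁻¹(y)R(V₀(Γ_{y,x}))v(x)]`".

THE CARRIER.  The concrete model of the B7 files (`B7Prop1Explicit` DICTIONARY): print's `Ω` ↦ the whole unit lattice `Site d = ℤ^d`
(the fine lattice of the display, spacing `1`); a point `y` of the `j` times coarser lattice `L^j·ℤ^d` is written `y = L^j·w`,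
`w ∈ ℤ^d` (`levelSite L j w`; this is the identification `Ω^{(j)} ≅ ℤ^d` of `B7Prop2Explicit.rescale`, (1) + p. 19 "`Ω^{(j)}` may be
replaced by any other lattice").  In these units (2) reads `B^j(L^j·w) = {x ∈ ℤ^d : L^jw_μ ≦ x_μ < L^jw_μ + L^j}` — THE BODY OF
`blockZ L j w` — and (3) is the finite union `blockZSet L j Λ = ⋃_{w∈Λ} B^j(L^j·w)`.  Already in the tree and REUSED, not restated:
`B7Prop5Flat.blockPt L j x = (x_i div L^j)_i` (the `w` with `x ∈ B^j(L^j·w)`), `B8Ineq130.fl` (its `j = 1` case), `B7Prop1Explicit.boxVec`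
(the offsets `[0, L)^d` indexing the sums of (42)/(78)), `B8Lemma1Lattice.InBlock L z x` (the `j = 1` block as a predicate,
`z_κ ≦ x_κ < z_κ + L`), `B7Eq84Concrete.brem`/`fl_decomp`, `B8Eq115GaugeFixing.fl_block`; the torus version of (2)–(3) with
`Setup`'s centred cubes is `B7SectAStatements.blockJ`/`blockJSet` (DIVERGENCE F3 there; here the anchor is print's corner).

WHAT THIS FILE PROVES (kernel, 0 sorry, standard axioms; 3 definitions with bodies (`levelSite`, `blockZ`, `blockZSet`), no `def … : Prop`).
* §1 `levelSite` (1), `levelSite_succ`, `rescale_eq_comp_levelSite`.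
* §2 `blockZ` (2) with `mem_blockZ` (the printed inequalities), `mem_blockZ_iff_blockPt` (`x ∈ B^j(L^jw) ↔ (x div L^j) = w`),
  `mem_blockZ_blockPt`, `existsUnique_blockZ` (= (4) for `Ω = ℤ^d`: the blocks of order `j` tile the lattice), `blockZ_disjoint`,
  `card_blockZ` (`|B^j(y)| = L^{jd}`), `blockZ_zero` (`B⁰(y) = {y}`).
* §3 `blockZSet` (3) = the printed union, `mem_blockZSet_iff`, `card_blockZSet`.
* §4 `j = 1` ("We will omit the subscript `j` if `j = 1`"): `mem_blockZ_one_iff_inBlock` (= `B8Lemma1Lattice.InBlock`),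
  `mem_blockZ_one_iff` (`x = Lw + r`, `r ∈ [0, L)^d`), `blockZ_one_eq_image`, `sum_blockZ_one` — a sum over `B(Lw)` IS the sum over
  the offsets `r : Fin d → Fin L` —, whence **`Xavg_eq_sum_blockZ`** (the exponent of (42) `B7Prop1Explicit.Xavg` at the `L`-bond
  `c = ⟨Lw, Lw + Le_κ⟩` is `Σ_{x∈B(c₋)} L^{−d} log U(Γ_{c,x})U(c)⁻¹` summed over print's block `B(c₋)`) and **`Sexp_eq_sum_blockZ`**
  (the exponent of (78) `B7Eq99Concrete.Sexp` at `y = Lw` is `Σ_{x∈B(y)} L^{−d} log g(y)⁻¹g(x)`).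
* §5 **`boxFinset_deltaHi_eq_union4`** — (46) p. 25 "`Δ(p′) = B(y₀) ∪ B(y₁) ∪ B(y₂) ∪ B(y)`": the union of the four corner blocks of an
  `L`-plaquette (`μ ≠ ν`) IS the coordinate box `[Lz, Lz + (L−1)𝟙 + Le_μ + Le_ν]` (`B7Prop1Local.deltaHi`, `B7Prop5Flat.boxFinset`) by
  which `B7Prop1Local` (locality of Prop. 1) encodes `Δ(p′)`.
p. 25 (46), verbatim: "If we denote `Δ(p′) = B(y₀) ∪ B(y₁) ∪ B(y₂) ∪ B(y)`, (46) then for `b ⊂ Δ(p′)` we have …" (`y₀, y₁, y₂, y` the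
corners of `p′`, figure p. 24; render `…-p009-x2.png` read).
Owner audit context: ROWS-B7 rows `B7.Eq1` ((1)–(3)), `B7.Def3` ((2)–(3)), `B7.Eq4` ((4)–(5)), `B7.Eq15` ((42)), `B7.Eq46` ((46)),
`B7.Eq78` ((78)): the corner-anchored bodies of (2)–(3) on the B7 concrete carrier.  Unit `lit-balaban-r04` gen 52, 2026-08-23.
-/

noncomputable section

open scoped BigOperators

namespace Literature.MathematicalPhysics.QuantumFieldTheory.Balaban1983to89.B7Eq2BlocksZd

open B7Prop1Explicit B7Prop2Explicit B7Prop5Flat B7Eq84Concrete B7Eq99Concrete MatrixLog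
open B8Ineq130 (fl)
open B8Lemma1Lattice (InBlock)
open B8Lemma1NonAbelian (inBlock_iff)
open B8Eq115GaugeFixing (fl_block)

-- `Site` alone would resolve to the torus sites of `Setup.lean`; re-export the `ℤ^d` sites of `B7Prop1Explicit`.
export B7Prop1Explicit (Site)

variable {d : ℕ}

/-! ## §1 (1): the level-`j` lattice `Ω^{(j)} = L^j·ℤ^d ⊂ ℤ^d` -/

/-- **(1)** p. 17, "`Ω^{(j)} = Ω ∩ L^jηZ^d`": on the unit-lattice carrier `Ω = ℤ^d` the level-`j` lattice is `L^j·ℤ^d`, parametrized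
by `w ↦ L^j·w` (the identification `Ω^{(j)} ≅ ℤ^d` of `B7Prop2Explicit.rescale`, p. 19 "`Ω^{(j)}` may be replaced by any other
lattice"). [cite: Balaban1985Averaging, (1) p.17, p.19] -/
def levelSite (L j : ℕ) (w : Site d) : Site d := ((L : ℤ) ^ j) • w

/-- `levelSite` unfolded. [cite: Balaban1985Averaging, (1) p.17] -/
@[simp] theorem levelSite_apply (L j : ℕ) (w : Site d) (i : Fin d) : levelSite L j w i = (L : ℤ) ^ j * w i := by
  simp [levelSite]

/-- `Ω^{(0)} = Ω`. [cite: Balaban1985Averaging, (1) p.17] -/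
@[simp] theorem levelSite_zero (L : ℕ) (w : Site d) : levelSite L 0 w = w := by
  funext i; simp

/-- `Ω^{(j+1)} = L·Ω^{(j)}`: one more coarsening step is the dilation by `L` (`rescale`). [cite: Balaban1985Averaging, (1) p.17] -/
theorem levelSite_succ (L j : ℕ) (w : Site d) : levelSite L (j + 1) w = (L : ℤ) • levelSite L j w := by
  funext i; simp [pow_succ]; ring

/-- `B7Prop2Explicit.rescale` reads a configuration on the bonds of `Ω^{(1)} = L·ℤ^d`: `rescale L W z = W(levelSite L 1 z)`.
[cite: Balaban1985Averaging, (1) p.17, (43) p.24] -/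
theorem rescale_eq_comp_levelSite {G : Type*} (L : ℕ) (W : Site d → Fin d → G) (z : Site d) :
    rescale L W z = W (levelSite L 1 z) := by
  funext κ; simp [levelSite, rescale_apply]

/-! ## §2 (2): the block of order `j` -/

/-- **(2)** p. 17, verbatim: "`B^j(y) = {x ∈ L^{−j}L^nηZ^d : y_μ ≦ x_μ < y_μ + L^nη, μ = 1, …, d}`" — on the unit-lattice carrier,
for the point `y = L^j·w` of the level-`j` lattice: the finite set `{x ∈ ℤ^d : L^jw_μ ≦ x_μ < L^jw_μ + L^j, μ = 1, …, d}` (corner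
anchored at `y`, side `L^j`). [cite: Balaban1985Averaging, (2) p.17] -/
def blockZ (L j : ℕ) (w : Site d) : Finset (Site d) :=
  Fintype.piFinset fun i => Finset.Ico ((L : ℤ) ^ j * w i) ((L : ℤ) ^ j * w i + (L : ℤ) ^ j)

/-- **(2)**, the printed inequalities: `x ∈ B^j(L^jw) ↔ ∀ μ, L^jw_μ ≦ x_μ < L^jw_μ + L^j`. [cite: Balaban1985Averaging, (2) p.17] -/
theorem mem_blockZ {L j : ℕ} {w x : Site d} :
    x ∈ blockZ L j w ↔ ∀ i, (L : ℤ) ^ j * w i ≤ x i ∧ x i < (L : ℤ) ^ j * w i + (L : ℤ) ^ j := by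
  simp [blockZ, Fintype.mem_piFinset, Finset.mem_Ico]

/-- Euclidean division: `a div P = w ↔ Pw ≦ a < Pw + P` (`P > 0`). [folklore] -/
private theorem ediv_eq_iff_of_pos {P : ℤ} (hP : 0 < P) {a w : ℤ} : a / P = w ↔ P * w ≤ a ∧ a < P * w + P := by
  rw [le_antisymm_iff, ← Int.lt_add_one_iff, Int.ediv_lt_iff_lt_mul hP, Int.le_ediv_iff_mul_le hP]
  have h1 : (w + 1) * P = P * w + P := by ring
  have h2 : w * P = P * w := mul_comm _ _
  rw [h1, h2]
  exact and_comm

/-- `x ∈ B^j(L^jw) ↔ blockPt L j x = w`: the block of order `j` containing `x` is the one over `(x_i div L^j)_i`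
(`B7Prop5Flat.blockPt`). [cite: Balaban1985Averaging, (2) p.17] -/
theorem mem_blockZ_iff_blockPt {L : ℕ} (hL : 1 ≤ L) {j : ℕ} {w x : Site d} : x ∈ blockZ L j w ↔ blockPt L j x = w := by
  have hP : (0 : ℤ) < (L : ℤ) ^ j := pow_pos (by exact_mod_cast hL) j
  rw [mem_blockZ, funext_iff]
  refine forall_congr' fun i => ?_
  simp only [blockPt]
  exact (ediv_eq_iff_of_pos hP).symm

/-- Every site lies in the block of order `j` over `blockPt L j x`. [cite: Balaban1985Averaging, (2) p.17, (4) p.18] -/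
theorem mem_blockZ_blockPt {L : ℕ} (hL : 1 ≤ L) (j : ℕ) (x : Site d) : x ∈ blockZ L j (blockPt L j x) :=
  (mem_blockZ_iff_blockPt hL).2 rfl

/-- **(4) for `Ω = ℤ^d`** ("`B^j(Ω^{(j)}) = Ω` … Thus `Ω` is a sum of blocks of the order `k`", p. 18): every site of the unit lattice
lies in exactly one block of order `j`. [cite: Balaban1985Averaging, (4) p.18, (2) p.17] -/
theorem existsUnique_blockZ {L : ℕ} (hL : 1 ≤ L) (j : ℕ) (x : Site d) : ∃! w : Site d, x ∈ blockZ L j w :=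
  ⟨blockPt L j x, mem_blockZ_blockPt hL j x, fun _ hw => ((mem_blockZ_iff_blockPt hL).1 hw).symm⟩

/-- Distinct level-`j` points have disjoint blocks of order `j`. [cite: Balaban1985Averaging, (2) p.17] -/
theorem blockZ_disjoint {L : ℕ} (hL : 1 ≤ L) {j : ℕ} {w w' : Site d} (h : w ≠ w') :
    Disjoint (blockZ L j w) (blockZ L j w') :=
  Finset.disjoint_left.2 fun _ hx hx' => h (((mem_blockZ_iff_blockPt hL).1 hx).symm.trans ((mem_blockZ_iff_blockPt hL).1 hx'))

/-- `|B^j(y)| = (L^j)^d = L^{dj}`. [cite: Balaban1985Averaging, (2) p.17] -/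
theorem card_blockZ (L j : ℕ) (w : Site d) : (blockZ L j w).card = (L ^ j) ^ d := by
  simp only [blockZ, Fintype.card_piFinset, Int.card_Ico, add_sub_cancel_left]
  rw [show ((L : ℤ) ^ j).toNat = L ^ j by rw [← Nat.cast_pow, Int.toNat_natCast], Finset.prod_const, Finset.card_univ,
    Fintype.card_fin]

/-- `B⁰(y) = {y}`. [cite: Balaban1985Averaging, (2) p.17] -/
theorem blockZ_zero (L : ℕ) (w : Site d) : blockZ L 0 w = {w} := by
  ext x
  rw [mem_blockZ, Finset.mem_singleton, funext_iff]
  refine forall_congr' fun i => ?_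
  simp only [pow_zero, one_mul]
  omega

/-! ## §3 (3): the block set of a subset of the level-`j` lattice -/

/-- **(3)** p. 17, verbatim: "`B^j(Λ) = ⋃_{y∈Λ} B^j(y)`" — for a finite set `Λ` of level-`j` points (written `y = L^j·w`, `w ∈ Λ`).
[cite: Balaban1985Averaging, (3) p.17] -/
def blockZSet (L j : ℕ) (Λ : Finset (Site d)) : Finset (Site d) := Λ.biUnion (blockZ L j)

/-- `x ∈ B^j(Λ) ↔` the level-`j` point under `x` lies in `Λ`. [cite: Balaban1985Averaging, (3) p.17] -/
theorem mem_blockZSet_iff {L : ℕ} (hL : 1 ≤ L) {j : ℕ} {Λ : Finset (Site d)} {x : Site d} :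
    x ∈ blockZSet L j Λ ↔ blockPt L j x ∈ Λ := by
  simp only [blockZSet, Finset.mem_biUnion, mem_blockZ_iff_blockPt hL]
  constructor
  · rintro ⟨w, hw, rfl⟩; exact hw
  · intro h; exact ⟨_, h, rfl⟩

/-- `B^j({y}) = B^j(y)`. [cite: Balaban1985Averaging, (3) p.17] -/
theorem blockZSet_singleton (L j : ℕ) (w : Site d) : blockZSet L j {w} = blockZ L j w := by
  simp [blockZSet]

/-- `|B^j(Λ)| = |Λ|·L^{dj}` (the union (3) is disjoint). [cite: Balaban1985Averaging, (3) p.17] -/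
theorem card_blockZSet {L : ℕ} (hL : 1 ≤ L) (j : ℕ) (Λ : Finset (Site d)) :
    (blockZSet L j Λ).card = Λ.card * (L ^ j) ^ d := by
  rw [blockZSet, Finset.card_biUnion (fun w _ w' _ h => blockZ_disjoint hL h)]
  simp [card_blockZ]

/-! ## §4 `j = 1`: "We will omit the subscript `j` if `j = 1`" — the blocks `B(y)` indexing the averages (42), (78) -/

/-- At `j = 1`, `blockPt` is `B8Ineq130.fl` (coordinatewise `x_i div L`): the block `B(y)`, `y = L·fl x`, of (2) containing `x`.
[cite: Balaban1985Averaging, (2) p.17] -/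
theorem blockPt_one (L : ℕ) (x : Site d) : blockPt L 1 x = fl L x := by
  funext i; simp [blockPt, fl]

/-- The `j = 1` block is the corner block predicate `B8Lemma1Lattice.InBlock` of the tree at the corner `y = L·w`:
`x ∈ B(Lw) ↔ ∀ κ, Lw_κ ≦ x_κ < Lw_κ + L`. [cite: Balaban1985Averaging, (2) p.17] -/
theorem mem_blockZ_one_iff_inBlock {L : ℕ} {w x : Site d} : x ∈ blockZ L 1 w ↔ InBlock L ((L : ℤ) • w) x := by
  rw [mem_blockZ]
  refine forall_congr' fun κ => ?_
  simp [pow_one]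

/-- `x ∈ B(Lw) ↔ x = Lw + r` for an offset `r ∈ [0, L)^d` (`B7Prop1Explicit.boxVec`). [cite: Balaban1985Averaging, (2) p.17] -/
theorem mem_blockZ_one_iff {L : ℕ} {w x : Site d} : x ∈ blockZ L 1 w ↔ ∃ r : Fin d → Fin L, x = (L : ℤ) • w + boxVec L r := by
  rw [mem_blockZ_one_iff_inBlock, inBlock_iff]

/-- `B(Lw) = {Lw + r : r ∈ [0, L)^d}` as a finite set. [cite: Balaban1985Averaging, (2) p.17] -/
theorem blockZ_one_eq_image {L : ℕ} (w : Site d) :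
    blockZ L 1 w = Finset.univ.image fun r : Fin d → Fin L => (L : ℤ) • w + boxVec L r := by
  ext x
  rw [mem_blockZ_one_iff, Finset.mem_image]
  simp only [Finset.mem_univ, true_and, eq_comm]

/-- The offsets `r ∈ [0, L)^d` parametrize the block `B(Lw)` of (2) injectively: `Lw + r = Lw + r′ → r = r′`.
[cite: Balaban1985Averaging, (2) p.17] -/
theorem boxVec_add_injective {L : ℕ} (hL : 1 ≤ L) (w : Site d) :
    Function.Injective fun r : Fin d → Fin L => (L : ℤ) • w + boxVec L r := fun r r' h => by
  have h' := congrArg (brem L hL) h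
  simpa only [brem_block] using h'

/-- **A sum over the block `B(Lw)` IS the sum over the offsets `r ∈ [0, L)^d`** — the form in which the B7 files write the sums
`Σ_{x∈B(c₋)}` of (42) and `Σ_{x∈B(y)}` of (78). [cite: Balaban1985Averaging, (2) p.17, (42) p.23, (78) p.30] -/
theorem sum_blockZ_one {M : Type*} [AddCommMonoid M] {L : ℕ} (hL : 1 ≤ L) (w : Site d) (f : Site d → M) :
    ∑ x ∈ blockZ L 1 w, f x = ∑ r : Fin d → Fin L, f ((L : ℤ) • w + boxVec L r) := by
  rw [blockZ_one_eq_image, Finset.sum_image fun r _ r' _ h => boxVec_add_injective hL w h]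


/-! ## §5 (46): `Δ(p′) = B(y₀) ∪ B(y₁) ∪ B(y₂) ∪ B(y)` — the four corner blocks of an `L`-plaquette form the box of `B7Prop1Local.deltaHi` -/

/-- **(46)** p. 25, verbatim: "`Δ(p′) = B(y₀) ∪ B(y₁) ∪ B(y₂) ∪ B(y)`" (the blocks at the four corners `y₀ = Lz`, `y₁ = L(z + e_μ)`,
`y₂ = L(z + e_ν)`, `y = L(z + e_μ + e_ν)` of the plaquette `p′` of the `L`-lattice with lower corner `Lz` spanned by `e_μ, e_ν`,
`μ ≠ ν`) — EQUALS the coordinate box `[Lz, Lz + (L−1)𝟙 + Le_μ + Le_ν]` by which the B7 files encode `Δ(p′)`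
(`B7Prop1Local.deltaHi`, `B7Prop5Flat.boxFinset`). [cite: Balaban1985Averaging, (46) p.25, (2) p.17] -/
theorem boxFinset_deltaHi_eq_union4 {L : ℕ} (hL : 1 ≤ L) (z : Site d) {μ ν : Fin d} (hμν : μ ≠ ν) :
    boxFinset ((L : ℤ) • z) (B7Prop1Local.deltaHi L ((L : ℤ) • z) μ ν)
      = blockZ L 1 z ∪ blockZ L 1 (z + e μ) ∪ blockZ L 1 (z + e ν) ∪ blockZ L 1 (z + e μ + e ν) := by
  have hL0 : (1 : ℤ) ≤ L := by exact_mod_cast hL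
  ext x
  simp only [Finset.mem_union, mem_boxFinset, B7Prop1Local.InBox, mem_blockZ, B7Prop1Local.deltaHi, Pi.add_apply,
    Pi.smul_apply, smul_eq_mul, pow_one, e_apply, mul_add, mul_ite, mul_one, mul_zero]
  constructor
  · intro h
    have hμ := h μ
    have hν := h ν
    simp only [if_true, true_or, or_true] at hμ hν
    by_cases ha : x μ < (L : ℤ) * z μ + L <;> by_cases hb : x ν < (L : ℤ) * z ν + L
    · refine Or.inl (Or.inl (Or.inl fun i => ?_))
      have hi := h i
      by_cases hiμ : i = μ
      · subst hiμ; simp only [if_true, true_or] at hi ⊢; omega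
      · by_cases hiν : i = ν
        · subst hiν; simp only [if_true, or_true] at hi ⊢; omega
        · simp only [hiμ, hiν, if_false, or_self] at hi ⊢; omega
    · refine Or.inl (Or.inr fun i => ?_)
      have hi := h i
      by_cases hiμ : i = μ
      · subst hiμ; simp only [if_true, true_or, hμν, if_false] at hi ⊢; omega
      · by_cases hiν : i = ν
        · subst hiν; simp only [if_true, or_true, hiμ] at hi ⊢; omega
        · simp only [hiμ, hiν, if_false, or_self] at hi ⊢; omega
    · refine Or.inl (Or.inl (Or.inr fun i => ?_))
      have hi := h i
      by_cases hiμ : i = μ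
      · subst hiμ; simp only [if_true, true_or, hμν] at hi ⊢; omega
      · by_cases hiν : i = ν
        · subst hiν; simp only [if_true, or_true, hiμ, if_false] at hi ⊢; omega
        · simp only [hiμ, hiν, if_false, or_self] at hi ⊢; omega
    · refine Or.inr fun i => ?_
      have hi := h i
      by_cases hiμ : i = μ
      · subst hiμ; simp only [if_true, true_or, hμν, if_false] at hi ⊢; omega
      · by_cases hiν : i = ν
        · subst hiν; simp only [if_true, or_true, hiμ, if_false] at hi ⊢; omega
        · simp only [hiμ, hiν, if_false, or_self] at hi ⊢; omega
  · rintro (((h | h) | h) | h) <;> intro i <;> have hi := h i <;>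
      (by_cases hiμ : i = μ
       · subst hiμ; simp only [if_true, true_or, hμν, if_false] at hi ⊢; omega
       · by_cases hiν : i = ν
         · subst hiν; simp only [if_true, or_true, hiμ, if_false] at hi ⊢; omega
         · simp only [hiμ, hiν, if_false, or_self] at hi ⊢; omega)

section Averages

variable {𝔸 : Type*} [NormedRing 𝔸] [NormedAlgebra ℂ 𝔸]

/-- **(42) p. 23 summed over print's block**: at the `L`-bond `c = ⟨Lw, Lw + Le_κ⟩` of `Ω^{(1)}` (`c₋ = Lw`), the exponent
`B7Prop1Explicit.Xavg` of the average `bavg` is `Σ_{x∈B(c₋)} L^{−d} log U(Γ_{c,x})U(c)⁻¹`, the contour `Γ_{c,x}` of the block point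
`x` being `gammaWord L κ (x − c₋)` (`Wcx`). [cite: Balaban1985Averaging, (42) p.23, (2) p.17] -/
theorem Xavg_eq_sum_blockZ {L : ℕ} (hL : 1 ≤ L) (V : Site d → Fin d → 𝔸ˣ) (w : Site d) (κ : Fin d) :
    Xavg L V ((L : ℤ) • w) κ
      = ∑ x ∈ blockZ L 1 w, (((L : ℝ) ^ d)⁻¹) • mlog ((Wcx L V ((L : ℤ) • w) κ (x - (L : ℤ) • w) : 𝔸ˣ) : 𝔸) := by
  rw [sum_blockZ_one hL]
  simp only [add_sub_cancel_left]
  rfl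

/-- **(78) p. 30 summed over print's block**: at the point `y = Lw` of `Ω′^{(1)}`, the exponent `B7Eq99Concrete.Sexp` of the site
average `{g(x)}_{x∈B(y)}` is `Σ_{x∈B(y)} L^{−d} log g(y)⁻¹g(x)`. [cite: Balaban1985Averaging, (78) p.30, (2) p.17] -/
theorem Sexp_eq_sum_blockZ {L : ℕ} (hL : 1 ≤ L) (g : Site d → 𝔸ˣ) (w : Site d) :
    Sexp L g ((L : ℤ) • w) = ∑ x ∈ blockZ L 1 w, (((L : ℝ) ^ d)⁻¹) • mlog ((((g ((L : ℤ) • w))⁻¹ * g x : 𝔸ˣ)) : 𝔸) := by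
  rw [sum_blockZ_one hL]
  rfl

end Averages

end Literature.MathematicalPhysics.QuantumFieldTheory.Balaban1983to89.B7Eq2BlocksZd
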